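import Mathlib
import HarnessLib
import Summits.RiemannHypothesis.RiemannHypothesis.Theses.SuzukiWindowsDoor

/-!
# RiemannHypothesis / SuzukiWindowsDoor — support item `ContractionGivesWitness` (stmt-RiemannHypothesis-19735) PROVED

RH-FREE, ζ-FREE, K-general: if `K : ℝ → ℝ` is a line contraction from every `L²(−t,t)` (the conclusion of the
route's crux A1), then the window average `W_K(x) = ∫_{(0,1)} K(x+y) dy` is in `L²(ℝ)` — take `t = 1` and the
test function `f = 1_{(0,1)}`. K-general port (planner rh-dbr-theory g5, `ports/SuzukiWindowsDoorContractionGivesWitness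
.scratch.lean`, farm-verified) of the cell's `limContractionGivesWitness_holds`. Nothing here bears on the truth of RH.
-/

noncomputable section

-- D-0017: `Summit.<S>.<S>.…` is the designed namespace of a single-problem summit.
set_option linter.dupNamespace false

open MeasureTheory

namespace Summit.RiemannHypothesis.RiemannHypothesis.Theorems

/-- **Route `SuzukiWindowsDoor`, support item `ContractionGivesWitness` (stmt-RiemannHypothesis-19735) — PROVED
(RH-FREE, ζ-FREE).** A line contraction from every `L²(−t,t)` has its `(0,1)`-window average in `L²(ℝ)`
(test `f = 1_{(0,1)}` at `t = 1`). -/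
theorem suzukiWindowsDoor_contractionGivesWitness_proof :
    Summit.RiemannHypothesis.RiemannHypothesis.Theses.SuzukiWindowsDoor.ContractionGivesWitness := by
  intro K hC
  set f : ℝ → ℝ := Set.indicator (Set.Ioo 0 1) (fun _ => (1 : ℝ)) with hf
  have hfin : (volume.restrict (Set.Ioo (-1 : ℝ) 1)) (Set.Ioo 0 1) ≠ ⊤ := by
    rw [Measure.restrict_apply measurableSet_Ioo]
    exact ((measure_mono Set.inter_subset_left).trans_lt (by simp [Real.volume_Ioo])).ne
  have hfm : MemLp f 2 (volume.restrict (Set.Ioo (-1 : ℝ) 1)) :=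
    memLp_indicator_const 2 measurableSet_Ioo (1 : ℝ) (Or.inr hfin)
  obtain ⟨hmem, -⟩ := hC 1 zero_le_one f hfm
  have heq : (fun x : ℝ => ∫ y in Set.Ioo (-1 : ℝ) 1, K (x + y) * f y) =
      fun x : ℝ => ∫ y in Set.Ioo (0 : ℝ) 1, K (x + y) := by
    funext x
    have hpt : ∀ y : ℝ, K (x + y) * f y = Set.indicator (Set.Ioo 0 1) (fun y => K (x + y)) y := by
      intro y
      by_cases hy : y ∈ Set.Ioo (0 : ℝ) 1 <;> simp [hf, hy]
    simp_rw [hpt]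
    rw [setIntegral_indicator measurableSet_Ioo,
      Set.inter_eq_right.2 (Set.Ioo_subset_Ioo (by norm_num) le_rfl)]
  rw [← heq]
  exact hmem

end Summit.RiemannHypothesis.RiemannHypothesis.Theorems

end
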